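import Summits.QuantumFields.YangMills.Theorems.BalabanUVNodesN15KingModelAnalyticBlockCovHolomorphy
import HarnessLib

/-!
# BalabanUVNodes ∕ N15 — THE KING-MODEL RUNG (PART Ϫ-e, `𝕜 = ℂ`): CAUCHY's ESTIMATES WITH DECAY FOR THE BLOCK-FIELD COVARIANCE AND ITS `η`-UNIFORM LIPSCHITZ DEPENDENCE ON THE
# BACKGROUND WITH KING's `C^{(k)}` DECAY (Lemma 4.5 (4.38)'s shape) — along every complex line `U₀ + tδU` (`‖δU_b‖ ≤ ε`, `L·R·ε ≤ s₀(m²,0,d)`, unitary `U₀` of ANY curvature) the blocks of `C(U,U⁻¹)` are holomorphic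
# in the disc `|t| < R` with ★★★★ ALL TAYLOR COEFFICIENTS OF ORDER `k ≥ 1` BOUNDED BY `(8∕m²)e³e^{−ctRate(m²∕2,0,d)d_M(y,y′)}∕Rᵏ` (no noise term), hence ★★★★
# `‖blk(C(U,U⁻¹) − C(U₀)) y y′‖ ≤ (16∕m²)e³(Lε∕s₀(m²,0,d))e^{−ctRate(m²∕2,0,d)d_M(y,y′)}` for COMPLEX `U` within `ε` of `U₀` (`2Lε ≤ s₀`), and at unitary endpoints
# `‖blk((Δ_eff(U₁))⁻¹ − (Δ_eff(U₀))⁻¹) y y′‖ ≤` the same — NE2's UNIT LAYER IS LIPSCHITZ IN THE BACKGROUND ON BAŁABAN's SCALE WITH ITS DECAY (PART Ϧ-l's operator bound had no decay)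
# (Track A, DAG node N15 = NE2; FAN-OUT v1.1 §N15 s3 «KING-MODEL RUNG … + what the curved case adds»; count-neutral)

HONEST FRAMING.  Count-neutral (cell `pub-ymgap`, seat `pub-ymgap-dag-n15-e` g52; `--supports stmt-QuantumFields-27247 --as helper` = K3ᴬ, KEY MAP v3).  King's one-level comparison model,
massive fine covariance `m² > 0`, fibre `ℂⁿ`, King's scaling `c = L²`, comb-depth contours; the window is the `B`-window `s₀(m²,0,d)` (the Woodbury form; PART Ϫ-d), independent of the
block coupling `a > 0` (which only enters the constant noise `a⁻¹1`).  Mechanism = PART Ϩ-i's (Cauchy on circles, mean value on the unit disc).  NOT Bałaban's multi-level `C^{(k)}`;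
NOT a node discharge (N15 of record untouched); nothing continuum ∕ ℝ⁴ ∕ OS ∕ Clay.

ERRATUM-Ϫ1 (v1.1, DOC-ONLY; ref-I READ-1090 N1, verified first-hand on the held page p.674 of [King1986]): (4.32) defines `C^{(k)}_Ω(s)`; the sentence after it states that `C^{(k)}_Ω(s)` «has uniform exponential decay» once (4.33) (the lower bound `C ≥ γ₀I`) and (4.34) (decay of `C⁻¹`) hold; (4.35)–(4.37) are the momentum sums proving (4.33); Lemma 4.5 = (4.38) is the two-spacing difference WITH decay; (4.44) p.675 is the resolvent∕Woodbury-type difference identity and (4.45) its Fourier representation.  v1.0 of this file cited «(4.37)» for the decay of `C^{(k)}` and «(4.45)» for the Woodbury form ∕ floors; v1.1 cites (4.32)–(4.34) for the decay, (4.38) for Lipschitz-with-decay shapes, (4.33) for lower bounds ∕ floors and (4.44) for the Woodbury form.  Declarations byte-identical to v1.0.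

THE RESULTS (unitary `U₀`, `‖δU_b‖ ≤ ε`, `0 < R`, `L(Rε) ≤ s₀(m²,0,d)`, `a, m² > 0`, `L ≥ 1`):
* §1 THE LINE: `blk_blockCovLine_eq` (`blk C(U₀+tδU) y y′ = a⁻¹[y=y′]1 + blk S₀(t) y y′`), ★ `differentiableAt_blk_zeroSandwichLine`, ★ `differentiableAt_blk_blockCovLine` (`|t| ≤ R`), `diffContOnCl_blk_zeroSandwichLine`,
  ★ `norm_blk_zeroSandwichLine_le` (`‖blk S₀(t) y y′‖ ≤ (8∕m²)e³e^{−ctRate(m²∕2,0,d)d_M(y,y′)}`), ★ `norm_blk_blockCovLine_le` (`+ a⁻¹[y=y′]`).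
* §2 CAUCHY: ★★★ `norm_iteratedDeriv_blk_zeroSandwichLine_le` (all `k`), ★★★★ **`norm_iteratedDeriv_blk_blockCovLine_le`** (`k ≥ 1`: `‖∂ᵏ_t blk C(U₀+tδU) y y′|₀‖ ≤ k!(8∕m²)e³e^{−ctRate(m²∕2,0,d)d_M(y,y′)}∕Rᵏ` —
  THE TAYLOR COEFFICIENTS OF NE2's UNIT LAYER IN THE BACKGROUND DECAY EXPONENTIALLY ON THE BLOCK LATTICE, uniformly in the volume, the spacing and the fibre), ★★ `norm_deriv_blk_blockCovLine_le` (`‖s‖ ≤ R∕2`).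
* §3 LIPSCHITZ: ★★★ `norm_blk_blockCovLine_sub_le` (`R ≥ 2`: `‖blk(C(U₀+δU) − C(U₀)) y y′‖ ≤ (16∕m²)e³e^{−δd_M}∕R`), ★★★★ **`norm_blk_cxBlockCov_sub_le_eta_uniform`** (COMPLEX `U`, `‖U−U₀‖ ≤ ε`, `0 < ε`, `2Lε ≤ s₀(m²,0,d)`:
  `≤ (16∕m²)e³(Lε∕s₀(m²,0,d))e^{−ctRate(m²∕2,0,d)d_M(y,y′)}`), ★★★★ **`norm_blk_effLapU_inv_sub_le_eta_uniform`** (UNITARY `U₀,U₁`: KING's `C^{(K)}(U) = (Δ_eff(U))⁻¹` IS LIPSCHITZ IN THE BACKGROUND ON BAŁABAN's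
  SCALE WITH ITS DECAY ((4.38)'s SHAPE) — every curvature, constants `(m²,d)` only).
PRIOR TREE ART (by name): Ϫ-a (`cxBlockCov`, `blk_cxBlockCov`, `blk_cxBlockCov_sub`, `cxBlockCov_inv_of_unitary`), Ϫ-b (`mass_coercive_fullOpU`, `norm_noise_blk_le`), Ϫ-d (`analyticAt_printBlockCov`, `isUnit_links_of_polydisc`),
Ϩ-l (`norm_blk_cxSandwich_at_radius_le`), Ϩ-i (`norm_line_sub_le`), Ϩ-g (`sliceRadius_pos`, `isUnit_cxFullOp_at_radius`), Ϩ-m (`analyticAt_cxSandwich_entry` via Ϫ-d `analyticAt_cxSandwich`), Ϩ-h (`analyticAt_sliceEmbed`), Ϛ-h (`cxBlkCLM`),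
Mathlib (`Complex.norm_iteratedDeriv_le_of_forall_mem_sphere_norm_le`, `Complex.norm_deriv_le_of_forall_mem_sphere_norm_le`, `Convex.norm_image_sub_le_of_norm_deriv_le`, `iteratedDeriv_const_add`).
Dedup (rg at filing): basename 0 files; needles `blockCovLine|zeroSandwichLine|norm_blk_cxBlockCov_sub_le_eta_uniform|norm_blk_effLapU_inv_sub_le` 0 tree files.  Locators: [King1986] (4.34)∕(4.32)–(4.34) p.674, (4.44) p.675;
[Balaban1985BackgroundPropagators] Thm 3.4 p.400, (3.48)–(3.50) pp.398–400, (3.57) p.401.  0 `sorry`, 0 `def`.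
-/

noncomputable section
open scoped BigOperators ComplexConjugate ComplexOrder Topology Matrix.Norms.L2Operator
open Finset Matrix Filter Metric Set

namespace Summit.QuantumFields.YangMills.BalabanUVNodes.N15KingModelRung.Analytic

open Literature.MathematicalPhysics.QuantumFieldTheory.LatticeDiamagneticInequality (blk)
open Literature.MathematicalPhysics.QuantumFieldTheory.Balaban1983to89.B5Prop11Plancherel (Tor fine)
open Literature.MathematicalPhysics.QuantumFieldTheory.King1986.Torus (tdistT tdistT_self)
open Summit.QuantumFields.YangMills.BalabanUVNodes.N15KingModelRung.Covariant (CxLinks cxBlkCLM blk_sub' blk_add' blk_smul' fib)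
open Summit.QuantumFields.YangMills.BalabanUVNodes.N15KingModelRung.CovariantBlock (BlockTree covQ fullOpU effLapU)
open Summit.QuantumFields.YangMills.BalabanUVNodes.N15KingModelRung.CombesThomas (ctRate)

variable {d : ℕ} {L : ℕ} [NeZero L] (T : BlockTree d L) (M : Fin (d + 1) → ℕ) [hM : ∀ μ, NeZero (M μ)]
variable {n : Type*} [Fintype n] [DecidableEq n]

/-! ## §1 The block-field covariance along a complex line inside the `B`-polydisc -/

section Line

variable (hD : ∀ j, T.depth j ≤ (d + 1) * (L - 1)) {a m2 : ℝ} (hm : 0 < m2) (hL : 1 ≤ L)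
variable {U₀ : Tor (fine L M) × Fin (d + 1) → Matrix n n ℂ} (hU₀ : ∀ bd, U₀ bd ∈ Matrix.unitaryGroup n ℂ)
variable {δU : Tor (fine L M) × Fin (d + 1) → Matrix n n ℂ} {ε R : ℝ} (hε0 : 0 ≤ ε) (hδU : ∀ bd, ‖δU bd‖ ≤ ε) (hR : 0 < R) (hrad : (L : ℝ) * (R * ε) ≤ sliceRadius m2 0 d)
include hD hm hL hU₀ hε0 hδU hR hrad

omit hD hm hL hU₀ hε0 hδU hR hrad in
/-- ALONG THE LINE THE NOISE IS CONSTANT: `blk C(U₀+tδU) y y′ = a⁻¹[y=y′]·1 + blk (Q B⁻¹ Q♯_K)(U₀+tδU) y y′`. [cite: King1986, (4.44) p.675] -/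
theorem blk_blockCovLine_eq (y y' : Tor M) :
    (fun s : ℂ => blk (cxBlockCov T M a ((L : ℝ) ^ 2) m2 (U₀ + s • δU) (fun bd => ((U₀ + s • δU) bd)⁻¹)) y y')
      = fun s : ℂ => (if y = y' then ((a : ℝ) : ℂ)⁻¹ else 0) • (1 : Matrix n n ℂ)
          + blk (covQ T M (U₀ + s • δU) * (cxFullOp T M 0 ((L : ℝ) ^ 2) m2 (U₀ + s • δU) (fun bd => ((U₀ + s • δU) bd)⁻¹))⁻¹ * cxKingQadj T M (fun bd => ((U₀ + s • δU) bd)⁻¹)) y y' :=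
  funext fun s => blk_cxBlockCov T M a ((L : ℝ) ^ 2) m2 (U₀ + s • δU) (fun bd => ((U₀ + s • δU) bd)⁻¹) y y'

/-- ★ THE ZERO-COUPLING SANDWICH BLOCK ALONG THE LINE IS ℂ-DIFFERENTIABLE for `|t| ≤ R`. [cite: Balaban1985BackgroundPropagators, Thm 3.4 p.400] -/
theorem differentiableAt_blk_zeroSandwichLine {t : ℂ} (ht : ‖t‖ ≤ R) (y y' : Tor M) :
    DifferentiableAt ℂ (fun s : ℂ => blk (covQ T M (U₀ + s • δU) * (cxFullOp T M 0 ((L : ℝ) ^ 2) m2 (U₀ + s • δU) (fun bd => ((U₀ + s • δU) bd)⁻¹))⁻¹ * cxKingQadj T M (fun bd => ((U₀ + s • δU) bd)⁻¹)) y y') t := by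
  have hline : DifferentiableAt ℂ (fun s : ℂ => U₀ + s • δU) t := (differentiableAt_id.smul_const δU).const_add U₀
  have hUt : ∀ bd, ‖(U₀ + t • δU) bd - U₀ bd‖ ≤ R * ε := fun bd => (norm_line_sub_le M hδU t bd).trans (mul_le_mul_of_nonneg_right ht hε0)
  have hunit := isUnit_links_of_polydisc M hL hU₀ hUt hrad
  have hB : IsUnit (cxFullOp T M 0 ((L : ℝ) ^ 2) m2 (U₀ + t • δU) (fun bd => ((U₀ + t • δU) bd)⁻¹)) :=
    isUnit_cxFullOp_at_radius T M hD le_rfl hm.le hL hU₀ hm (mass_coercive_fullOpU T M le_rfl (by positivity) m2 hU₀) (mul_nonneg hR.le hε0) hUt hrad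
  have hS := (analyticAt_cxSandwich T M (UV₀ := ((U₀ + t • δU, fun bd => ((U₀ + t • δU) bd)⁻¹) : CxLinks (fine L M) ℂ n)) hB).comp_of_eq (analyticAt_sliceEmbed M hunit) rfl
  have e : (fun s : ℂ => blk (covQ T M (U₀ + s • δU) * (cxFullOp T M 0 ((L : ℝ) ^ 2) m2 (U₀ + s • δU) (fun bd => ((U₀ + s • δU) bd)⁻¹))⁻¹ * cxKingQadj T M (fun bd => ((U₀ + s • δU) bd)⁻¹)) y y')
      = (fun A => blk A y y') ∘ ((fun UV : CxLinks (fine L M) ℂ n => covQ T M UV.1 * (cxFullOp T M 0 ((L : ℝ) ^ 2) m2 UV.1 UV.2)⁻¹ * cxKingQadj T M UV.2)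
          ∘ (fun U : Tor (fine L M) × Fin (d + 1) → Matrix n n ℂ => ((U, fun bd => (U bd)⁻¹) : CxLinks (fine L M) ℂ n))) ∘ (fun s : ℂ => U₀ + s • δU) := rfl
  rw [e]
  exact ((cxBlkCLM M ℂ n y y').analyticAt _).differentiableAt.comp t (hS.differentiableAt.comp t hline)

/-- ★ THE COVARIANCE BLOCK ALONG THE LINE IS ℂ-DIFFERENTIABLE for `|t| ≤ R`. [cite: Balaban1985BackgroundPropagators, Thm 3.4 p.400; King1986, (4.44) p.675] -/
theorem differentiableAt_blk_blockCovLine {t : ℂ} (ht : ‖t‖ ≤ R) (y y' : Tor M) :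
    DifferentiableAt ℂ (fun s : ℂ => blk (cxBlockCov T M a ((L : ℝ) ^ 2) m2 (U₀ + s • δU) (fun bd => ((U₀ + s • δU) bd)⁻¹)) y y') t := by
  rw [blk_blockCovLine_eq]
  exact (differentiableAt_const _).add (differentiableAt_blk_zeroSandwichLine T M hD hm hL hU₀ hε0 hδU hR hrad ht y y')

/-- ★ `DiffContOnCl` of the sandwich block on the disc `|t| < R`. [cite: Balaban1985BackgroundPropagators, Thm 3.4 p.400] -/
theorem diffContOnCl_blk_zeroSandwichLine (y y' : Tor M) :
    DiffContOnCl ℂ (fun s : ℂ => blk (covQ T M (U₀ + s • δU) * (cxFullOp T M 0 ((L : ℝ) ^ 2) m2 (U₀ + s • δU) (fun bd => ((U₀ + s • δU) bd)⁻¹))⁻¹ * cxKingQadj T M (fun bd => ((U₀ + s • δU) bd)⁻¹)) y y') (ball (0 : ℂ) R) := by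
  refine DifferentiableOn.diffContOnCl ?_
  rw [closure_ball (0 : ℂ) hR.ne']
  intro t ht
  have htR : ‖t‖ ≤ R := by simpa only [mem_closedBall, dist_zero_right] using ht
  exact (differentiableAt_blk_zeroSandwichLine T M hD hm hL hU₀ hε0 hδU hR hrad htR y y').differentiableWithinAt

/-- ★ THE UNIFORM BOUND ON THE CLOSED DISC for the sandwich block: `‖blk S₀(t) y y′‖ ≤ (8∕m²)e³e^{−ctRate(m²∕2,0,d)d_M(y,y′)}` (`|t| ≤ R`). [cite: King1986, (4.34) p.674; Dimock2013, App. D, Lemma 30] -/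
theorem norm_blk_zeroSandwichLine_le {t : ℂ} (ht : ‖t‖ ≤ R) (y y' : Tor M) :
    ‖blk (covQ T M (U₀ + t • δU) * (cxFullOp T M 0 ((L : ℝ) ^ 2) m2 (U₀ + t • δU) (fun bd => ((U₀ + t • δU) bd)⁻¹))⁻¹ * cxKingQadj T M (fun bd => ((U₀ + t • δU) bd)⁻¹)) y y'‖
      ≤ 8 / m2 * Real.exp 3 * Real.exp (-(ctRate (m2 / 2) 0 d * tdistT M y y')) := by
  have hUt : ∀ bd, ‖(U₀ + t • δU) bd - U₀ bd‖ ≤ R * ε := fun bd => (norm_line_sub_le M hδU t bd).trans (mul_le_mul_of_nonneg_right ht hε0)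
  exact norm_blk_cxSandwich_at_radius_le T M hD le_rfl hm.le hL hU₀ hm (mass_coercive_fullOpU T M le_rfl (by positivity) m2 hU₀) (mul_nonneg hR.le hε0) hUt hrad y y'

/-- ★ THE UNIFORM BOUND ON THE CLOSED DISC for the covariance block: `‖blk C(U₀+tδU) y y′‖ ≤ a⁻¹[y=y′] + (8∕m²)e³e^{−ctRate(m²∕2,0,d)d_M(y,y′)}`. [cite: King1986, (4.32)–(4.34) p.674, (4.44) p.675] -/
theorem norm_blk_blockCovLine_le (ha : 0 < a) {t : ℂ} (ht : ‖t‖ ≤ R) (y y' : Tor M) :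
    ‖blk (cxBlockCov T M a ((L : ℝ) ^ 2) m2 (U₀ + t • δU) (fun bd => ((U₀ + t • δU) bd)⁻¹)) y y'‖ ≤ (if y = y' then a⁻¹ else 0) + 8 / m2 * Real.exp 3 * Real.exp (-(ctRate (m2 / 2) 0 d * tdistT M y y')) := by
  rw [blk_cxBlockCov]
  exact (norm_add_le _ _).trans (add_le_add (norm_noise_blk_le M ha y y') (norm_blk_zeroSandwichLine_le T M hD hm hL hU₀ hε0 hδU hR hrad ht y y'))

/-! ## §2 Cauchy's estimates with decay -/

/-- ★★★ CAUCHY WITH DECAY, ALL ORDERS, for the sandwich block: `‖∂ᵏ_t blk S₀(t) y y′|₀‖ ≤ k!·(8∕m²)e³e^{−ctRate(m²∕2,0,d)d_M(y,y′)}∕Rᵏ`. [cite: Balaban1985BackgroundPropagators, Thm 3.4 p.400, (3.57) p.401; King1986, (4.34) p.674] -/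
theorem norm_iteratedDeriv_blk_zeroSandwichLine_le (k : ℕ) (y y' : Tor M) :
    ‖iteratedDeriv k (fun s : ℂ => blk (covQ T M (U₀ + s • δU) * (cxFullOp T M 0 ((L : ℝ) ^ 2) m2 (U₀ + s • δU) (fun bd => ((U₀ + s • δU) bd)⁻¹))⁻¹ * cxKingQadj T M (fun bd => ((U₀ + s • δU) bd)⁻¹)) y y') 0‖
      ≤ k.factorial * (8 / m2 * Real.exp 3 * Real.exp (-(ctRate (m2 / 2) 0 d * tdistT M y y'))) / R ^ k := by
  haveI : CompleteSpace (Matrix n n ℂ) := FiniteDimensional.complete ℂ _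
  refine Complex.norm_iteratedDeriv_le_of_forall_mem_sphere_norm_le k hR (diffContOnCl_blk_zeroSandwichLine T M hD hm hL hU₀ hε0 hδU hR hrad y y') fun t ht => ?_
  have htR : ‖t‖ = R := by simpa only [mem_sphere, dist_zero_right] using ht
  exact norm_blk_zeroSandwichLine_le T M hD hm hL hU₀ hε0 hδU hR hrad htR.le y y'

/-- ★★★★ **THE TAYLOR COEFFICIENTS OF NE2's UNIT LAYER IN THE BACKGROUND DECAY EXPONENTIALLY**: for `k ≥ 1`, `‖∂ᵏ_t blk C(U₀+tδU, (U₀+tδU)⁻¹) y y′|_{t=0}‖ ≤ k!·(8∕m²)e³·e^{−ctRate(m²∕2,0,d)·d_M(y,y′)}∕Rᵏ`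
— no noise term (it is constant along the line), constants `(m²,d)` only, uniform in the volume, the spacing `η = L⁻¹`, the fibre and the unitary centre `U₀` (any curvature).
[cite: King1986, (4.32)–(4.34) p.674, (4.44) p.675; Balaban1985BackgroundPropagators, Thm 3.4 p.400, (3.57) p.401] -/
theorem norm_iteratedDeriv_blk_blockCovLine_le {k : ℕ} (hk : 1 ≤ k) (y y' : Tor M) :
    ‖iteratedDeriv k (fun s : ℂ => blk (cxBlockCov T M a ((L : ℝ) ^ 2) m2 (U₀ + s • δU) (fun bd => ((U₀ + s • δU) bd)⁻¹)) y y') 0‖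
      ≤ k.factorial * (8 / m2 * Real.exp 3 * Real.exp (-(ctRate (m2 / 2) 0 d * tdistT M y y'))) / R ^ k := by
  rw [blk_blockCovLine_eq, iteratedDeriv_const_add (by omega)]
  exact norm_iteratedDeriv_blk_zeroSandwichLine_le T M hD hm hL hU₀ hε0 hδU hR hrad k y y'

/-- ★★ **THE FIRST DERIVATIVE IN THE HALF DISC**: for `‖s‖ ≤ R∕2`, `‖(d∕ds) blk C(U₀+sδU) y y′‖ ≤ (8∕m²)e³e^{−δd_M(y,y′)}∕(R∕2)` (Cauchy on the circle of radius `R∕2` about `s`).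
[cite: Balaban1985BackgroundPropagators, Thm 3.4 p.400, (3.48)–(3.50) pp.398–400] -/
theorem norm_deriv_blk_blockCovLine_le {s : ℂ} (hs : ‖s‖ ≤ R / 2) (y y' : Tor M) :
    ‖deriv (fun s : ℂ => blk (cxBlockCov T M a ((L : ℝ) ^ 2) m2 (U₀ + s • δU) (fun bd => ((U₀ + s • δU) bd)⁻¹)) y y') s‖
      ≤ (8 / m2 * Real.exp 3 * Real.exp (-(ctRate (m2 / 2) 0 d * tdistT M y y'))) / (R / 2) := by
  have hR2 : 0 < R / 2 := by positivity
  rw [blk_blockCovLine_eq, deriv_const_add]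
  refine Complex.norm_deriv_le_of_forall_mem_sphere_norm_le hR2 ?_ fun t ht => ?_
  · refine DifferentiableOn.diffContOnCl ?_
    rw [closure_ball s hR2.ne']
    intro t ht
    have hts : ‖t - s‖ ≤ R / 2 := by simpa only [mem_closedBall, dist_eq_norm] using ht
    have htR : ‖t‖ ≤ R := by
      calc ‖t‖ = ‖(t - s) + s‖ := by rw [sub_add_cancel]
        _ ≤ ‖t - s‖ + ‖s‖ := norm_add_le _ _
        _ ≤ R / 2 + R / 2 := add_le_add hts hs
        _ = R := by ring
    exact (differentiableAt_blk_zeroSandwichLine T M hD hm hL hU₀ hε0 hδU hR hrad htR y y').differentiableWithinAt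
  · have hts : ‖t - s‖ = R / 2 := by simpa only [mem_sphere, dist_eq_norm] using ht
    have htR : ‖t‖ ≤ R := by
      calc ‖t‖ = ‖(t - s) + s‖ := by rw [sub_add_cancel]
        _ ≤ ‖t - s‖ + ‖s‖ := norm_add_le _ _
        _ ≤ R / 2 + R / 2 := add_le_add hts.le hs
        _ = R := by ring
    exact norm_blk_zeroSandwichLine_le T M hD hm hL hU₀ hε0 hδU hR hrad htR y y'

/-! ## §3 Lipschitz in the background with the decay -/

/-- ★★★ **THE DIFFERENCE ACROSS THE LINE**: for `R ≥ 2`, `‖blk (C(U₀+δU) − C(U₀)) y y′‖ ≤ (16∕m²)e³·e^{−ctRate(m²∕2,0,d)d_M(y,y′)}∕R` (mean value on the unit disc). [cite: Balaban1985BackgroundPropagators, Thm 3.4 p.400, (3.48)–(3.50) pp.398–400; King1986, (4.32)–(4.34) p.674] -/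
theorem norm_blk_blockCovLine_sub_le (hR2 : 2 ≤ R) (y y' : Tor M) :
    ‖blk (cxBlockCov T M a ((L : ℝ) ^ 2) m2 (U₀ + δU) (fun bd => ((U₀ + δU) bd)⁻¹) - cxBlockCov T M a ((L : ℝ) ^ 2) m2 U₀ (fun bd => (U₀ bd)⁻¹)) y y'‖
      ≤ 16 / m2 * Real.exp 3 * Real.exp (-(ctRate (m2 / 2) 0 d * tdistT M y y')) / R := by
  set f : ℂ → Matrix n n ℂ := fun s => blk (cxBlockCov T M a ((L : ℝ) ^ 2) m2 (U₀ + s • δU) (fun bd => ((U₀ + s • δU) bd)⁻¹)) y y' with hf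
  set B : ℝ := 8 / m2 * Real.exp 3 * Real.exp (-(ctRate (m2 / 2) 0 d * tdistT M y y')) with hB
  have hball : ∀ s ∈ closedBall (0 : ℂ) 1, ‖s‖ ≤ R / 2 := fun s hs => by
    have : ‖s‖ ≤ 1 := by simpa only [mem_closedBall, dist_zero_right] using hs
    linarith
  have hdiff : ∀ s ∈ closedBall (0 : ℂ) 1, DifferentiableAt ℂ f s := fun s hs =>
    differentiableAt_blk_blockCovLine T M hD hm hL hU₀ hε0 hδU hR hrad ((hball s hs).trans (by linarith)) y y'
  have hbound : ∀ s ∈ closedBall (0 : ℂ) 1, ‖deriv f s‖ ≤ B / (R / 2) := fun s hs => norm_deriv_blk_blockCovLine_le T M hD hm hL hU₀ hε0 hδU hR hrad (hball s hs) y y'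
  have h := (convex_closedBall (0 : ℂ) 1).norm_image_sub_le_of_norm_deriv_le hdiff hbound (x := 0) (y := 1)
    (mem_closedBall_self zero_le_one) (by rw [mem_closedBall, dist_zero_right, norm_one])
  have e1 : f 1 = blk (cxBlockCov T M a ((L : ℝ) ^ 2) m2 (U₀ + δU) (fun bd => ((U₀ + δU) bd)⁻¹)) y y' := by simp only [hf, one_smul]
  have e0 : f 0 = blk (cxBlockCov T M a ((L : ℝ) ^ 2) m2 U₀ (fun bd => (U₀ bd)⁻¹)) y y' := by simp only [hf, zero_smul, add_zero]
  rw [blk_sub', ← e1, ← e0]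
  calc ‖f 1 - f 0‖ ≤ B / (R / 2) * ‖(1 : ℂ) - 0‖ := h
    _ = 16 / m2 * Real.exp 3 * Real.exp (-(ctRate (m2 / 2) 0 d * tdistT M y y')) / R := by rw [sub_zero, norm_one, mul_one, hB]; ring

end Line

/-! ## §3 (continued) The `η`-uniform constants: complex and unitary endpoints -/

section Lipschitz

variable (hD : ∀ j, T.depth j ≤ (d + 1) * (L - 1)) {a m2 : ℝ} (hm : 0 < m2) (hL : 1 ≤ L)
variable {U₀ U : Tor (fine L M) × Fin (d + 1) → Matrix n n ℂ} (hU₀ : ∀ bd, U₀ bd ∈ Matrix.unitaryGroup n ℂ)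
variable {ε : ℝ} (hε : 0 < ε) (hU : ∀ bd, ‖U bd - U₀ bd‖ ≤ ε) (h2 : 2 * ((L : ℝ) * ε) ≤ sliceRadius m2 0 d)
include hD hm hL hU₀ hε hU h2

/-- ★★★★ **NE2's UNIT LAYER IS LIPSCHITZ IN THE BACKGROUND ON BAŁABAN's SCALE WITH KING's `C^{(k)}` DECAY ((4.38)'s SHAPE) — COMPLEX ENDPOINT**: unitary `U₀` (any curvature), COMPLEX `U` with `‖U_b − U₀_b‖ ≤ ε` on
every bond, `0 < ε`, `2Lε ≤ s₀(m²,0,d)`:  `‖blk (C(U,U⁻¹) − C(U₀,U₀⁻¹)) y y′‖ ≤ (16∕m²)e³·(Lε∕s₀(m²,0,d))·e^{−ctRate(m²∕2,0,d)·d_M(y,y′)}` — linear in `ε∕η`, constants `(m²,d)` only.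
[cite: King1986, Lemma 4.5 (4.38) p.674, (4.44) p.675; Balaban1985BackgroundPropagators, Thm 3.4 p.400, (3.48)–(3.50) pp.398–400] -/
theorem norm_blk_cxBlockCov_sub_le_eta_uniform (y y' : Tor M) :
    ‖blk (cxBlockCov T M a ((L : ℝ) ^ 2) m2 U (fun bd => (U bd)⁻¹) - cxBlockCov T M a ((L : ℝ) ^ 2) m2 U₀ (fun bd => (U₀ bd)⁻¹)) y y'‖
      ≤ 16 / m2 * Real.exp 3 * ((L : ℝ) * ε / sliceRadius m2 0 d) * Real.exp (-(ctRate (m2 / 2) 0 d * tdistT M y y')) := by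
  have hs0 : 0 < sliceRadius m2 0 d := sliceRadius_pos hm le_rfl d
  have hL0 : (0 : ℝ) < L := by exact_mod_cast hL
  have hLε : 0 < (L : ℝ) * ε := mul_pos hL0 hε
  set R : ℝ := sliceRadius m2 0 d / ((L : ℝ) * ε) with hRdef
  have hR0 : 0 < R := div_pos hs0 hLε
  have hR2 : 2 ≤ R := by rw [hRdef, le_div_iff₀ hLε]; exact h2
  have hrad : (L : ℝ) * (R * ε) ≤ sliceRadius m2 0 d := by
    rw [hRdef, show (L : ℝ) * (sliceRadius m2 0 d / ((L : ℝ) * ε) * ε) = sliceRadius m2 0 d by field_simp]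
  have hδU : ∀ bd, ‖(U - U₀) bd‖ ≤ ε := fun bd => by rw [Pi.sub_apply]; exact hU bd
  have h := norm_blk_blockCovLine_sub_le T M hD hm hL hU₀ hε.le hδU hR0 hrad hR2 (a := a) y y'
  rw [add_sub_cancel] at h
  refine h.trans (le_of_eq ?_)
  rw [hRdef]
  field_simp

/-- ★★★★ **KING's BLOCK-FIELD COVARIANCE `C^{(K)}(U) = (Δ_eff(U))⁻¹` IS LIPSCHITZ IN THE BACKGROUND ON BAŁABAN's SCALE, WITH ITS DECAY ((4.38)'s SHAPE)**: UNITARY `U₀, U₁` (any curvature), `‖U₁_b − U₀_b‖ ≤ ε`,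
`0 < ε`, `2Lε ≤ s₀(m²,0,d)` (`a, m² > 0`, King's scaling, comb-depth contours, `L ≥ 1`):  `‖blk ((Δ_eff(U₁))⁻¹ − (Δ_eff(U₀))⁻¹) y y′‖ ≤ (16∕m²)e³·(Lε∕s₀(m²,0,d))·e^{−ctRate(m²∕2,0,d)·d_M(y,y′)}`
— one factor `e^{−ctRate}` per block of separation, linear in `ε∕η` (PART Ϧ-l's operator-norm Lipschitz bound had no decay). [cite: King1986, (2.14) p.653, Lemma 4.5 (4.38) p.674, (4.44) p.675; Balaban1985BackgroundPropagators, Thm 3.4 p.400] -/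
theorem norm_blk_effLapU_inv_sub_le_eta_uniform (ha : 0 < a) (hU₁ : ∀ bd, U bd ∈ Matrix.unitaryGroup n ℂ) (y y' : Tor M) :
    ‖blk ((effLapU T M a ((L : ℝ) ^ 2) m2 U)⁻¹ - (effLapU T M a ((L : ℝ) ^ 2) m2 U₀)⁻¹) y y'‖
      ≤ 16 / m2 * Real.exp 3 * ((L : ℝ) * ε / sliceRadius m2 0 d) * Real.exp (-(ctRate (m2 / 2) 0 d * tdistT M y y')) := by
  rw [← cxBlockCov_inv_of_unitary T M ha (by positivity) hm hU₁, ← cxBlockCov_inv_of_unitary T M ha (by positivity) hm hU₀]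
  exact norm_blk_cxBlockCov_sub_le_eta_uniform T M hD hm hL hU₀ hε hU h2 y y'

end Lipschitz

end Summit.QuantumFields.YangMills.BalabanUVNodes.N15KingModelRung.Analytic

end
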